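import Mathlib

/-!
# Level-independent certificates for the extended Galerkin generators from ONE head∣tail certificate (instab g15, cell `ns-blowup`, 2026-08-26)

HONEST FRAMING (human ruling D-0035): nothing here is a claim about Navier–Stokes blow-up.
WHAT THIS IS NOT: not NS evidence. This is the (α)-bookkeeping item of `instab/INSTAB-BRIDGE.md`
l.131 (c): the hypotheses (ii)–(iv) of `GalerkinEmergenceTrue.half_prediction_of_galerkin_limit` /
`decay_two_of_galerkin_limit` ask, at EVERY truncation level `n`, for the two-level and the strong
Lyapunov certificate of the level generator `A_n : E →L[ℝ] E` with level-INDEPENDENT scalars,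
for the bilinear loss (B) of the level nonlinearity `B_n`, and for the eigen-residual
`‖A_n (P_n v) − λ P_n v‖ → 0`. A head∣tail certificate of the cell (D2 / 3-L / 3-L′) is ONE
inequality for the untruncated operator `A` on finitely supported vectors, with block weights
(head block on the modes `≤ K_h`, diagonal analytic tail). This file shows, by inner-product
algebra alone, that such a certificate supplies the level hypotheses for the EXTENDED generators

  `A_n w = P_n (A (P_n w)) + μ · (w − P_n w)`   (`μ` real, acting as `(μ : 𝕜) •`),

which agree with the Galerkin field `P_n A P_n` on `range P_n` (so the Galerkin dynamics is
unchanged) and act as `μ · id` on the discarded modes. WHY THE EXTENSION: the plain truncation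
`P_n A P_n` annihilates the discarded modes, so a NEGATIVE strong certificate
(`Re⟪G w, A_n w⟫ ≤ ω₁ Re⟪G w, w⟫` with `ω₁ < 0`, the KILL case) is FALSE for it on vectors with tail
components; with `μ ≤ ω₁` (resp. `μ ≤ ω` and a tail domination for the two-level pair) the
extension repairs this at no cost.

Structural hypotheses (all satisfied by Fourier truncations `P_n`, `n ≥ K_h`, and block weights):
`P` idempotent and `G`-symmetric, `⟪G w, P z⟫ = ⟪G (P w), z⟫` (for an orthogonal projection
commuting with `G`). Results:

* `inner_weight_cross_eq_zero`, `inner_weight_add_of_proj`, `re_inner_weight_split` — the form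
  `⟪G·,·⟫` splits along `w = P w + (w − P w)` with no cross terms;
* `re_inner_weight_ext` — `Re⟪G w, A_n w⟫ = Re⟪G (P w), A (P w)⟫ + μ Re⟪G q, q⟫`, `q = w − P w`;
* `strong_certificate_ext` — (L) for `A` on `range P` + `μ ≤ ω₁` + `Re⟪G q, q⟫ ≥ 0` ⇒ (L) for
  `A_n` on ALL of `E` with the same `ω₁` (hypothesis `hL` of the g14/g15 theorems at level `n`);
* `two_level_certificate_ext`, `weak_certificate_ext` — the same for the coupled inequality
  `2Re⟪G₁w, A_n w⟫ + c Re⟪G₂w, w⟫ ≤ 2ω Re⟪G₁w, w⟫` (given the tail inequality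
  `2μ Re⟪G₁q,q⟫ + c Re⟪G₂q,q⟫ ≤ 2ω Re⟪G₁q,q⟫` on `ker P`, i.e. `μ ≤ ω − cκ/2` when `G₂ ≤ κ G₁`
  there) and for `Re⟪G₂w, A_n w⟫ ≤ ω Re⟪G₂w, w⟫`;
* `bilinear_loss_proj` — (B) for `B_n = P ∘ B` from (B) for `B` when `Re⟪D₁ q, q⟫ ≥ 0` on `ker P`
  (`P` is a `D₁`-contraction);
* `galerkin_field_ext` — the Galerkin structure hypothesis `P (F w) = A_n w + B_n (w, w)` on
  `W ∩ range P` from `F = A + B(·,·)` on `W`;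
* `eigen_residual_ext` — for a true eigenvector `A v = λ v`: `A_n (P v) − λ P v = −P (A (v − P v))`,
  so the consistency hypothesis (iv) reads `‖P_n A (v − P_n v)‖ → 0`.

Mathlib only; no new definitions; every statement is an identity/inequality between inner products.
-/

noncomputable section

namespace Summit.NavierStokesRegularity.FluidComputer.GalerkinCertificateTransfer

open RCLike
open scoped InnerProductSpace

variable {𝕜 E : Type*} [RCLike 𝕜] [NormedAddCommGroup E] [InnerProductSpace 𝕜 E]
  [NormedSpace ℝ E]

/-! ### Splitting of a block weight along a compatible projection -/

/-- **No cross terms.** If `P` is `G`-symmetric (`⟪G w, P z⟫ = ⟪G (P w), z⟫`) then for `q ∈ ker P`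
and any `w`: `⟪G (P w), q⟫ = 0` and `⟪G q, P w⟫ = 0`. -/
theorem inner_weight_cross_eq_zero {P G : E →L[ℝ] E}
    (hGP : ∀ w z : E, ⟪G w, P z⟫_𝕜 = ⟪G (P w), z⟫_𝕜) {q : E} (hq : P q = 0) (w : E) :
    ⟪G (P w), q⟫_𝕜 = 0 ∧ ⟪G q, P w⟫_𝕜 = 0 := by
  constructor
  · rw [← hGP w q, hq, inner_zero_right]
  · rw [hGP q w, hq, map_zero, inner_zero_left]

/-- **The weight form splits along `p + q`, `p ∈ range P`, `q ∈ ker P`.** -/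
theorem inner_weight_add_of_proj {P G : E →L[ℝ] E}
    (hGP : ∀ w z : E, ⟪G w, P z⟫_𝕜 = ⟪G (P w), z⟫_𝕜) {p q : E} (hp : P p = p) (hq : P q = 0) :
    ⟪G (p + q), p + q⟫_𝕜 = ⟪G p, p⟫_𝕜 + ⟪G q, q⟫_𝕜 := by
  obtain ⟨h1, h2⟩ := inner_weight_cross_eq_zero (𝕜 := 𝕜) hGP hq p
  rw [hp] at h1 h2
  rw [map_add, inner_add_left, inner_add_right, inner_add_right, h1, h2, add_zero, zero_add]

/-- **Splitting along the truncation:** for `P` idempotent and `G`-symmetric,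
`Re⟪G w, w⟫ = Re⟪G (P w), P w⟫ + Re⟪G (w − P w), w − P w⟫`. -/
theorem re_inner_weight_split {P G : E →L[ℝ] E}
    (hGP : ∀ w z : E, ⟪G w, P z⟫_𝕜 = ⟪G (P w), z⟫_𝕜) (hPidem : ∀ w : E, P (P w) = P w) (w : E) :
    re ⟪G w, w⟫_𝕜 = re ⟪G (P w), P w⟫_𝕜 + re ⟪G (w - P w), w - P w⟫_𝕜 := by
  have hq : P (w - P w) = 0 := by rw [map_sub, hPidem, sub_self]
  have h := inner_weight_add_of_proj (𝕜 := 𝕜) hGP (hPidem w) hq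
  rw [add_sub_cancel] at h
  rw [h, map_add]

/-! ### The extended generator `A_n = P A P + μ (1 − P)` -/

/-- **Pairing of the extended generator with a block weight.** For `P` idempotent and `G`-symmetric
and `A_n w = P (A (P w)) + μ (w − P w)`:
`Re⟪G w, A_n w⟫ = Re⟪G (P w), A (P w)⟫ + μ Re⟪G (w − P w), w − P w⟫`. -/
theorem re_inner_weight_ext {P G : E →L[ℝ] E}
    (hGP : ∀ w z : E, ⟪G w, P z⟫_𝕜 = ⟪G (P w), z⟫_𝕜) (hPidem : ∀ w : E, P (P w) = P w)
    {A : E → E} {An : E → E} {μ : ℝ}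
    (hAn : ∀ w : E, An w = P (A (P w)) + ((μ : 𝕜) • (w - P w))) (w : E) :
    re ⟪G w, An w⟫_𝕜 = re ⟪G (P w), A (P w)⟫_𝕜 + μ * re ⟪G (w - P w), w - P w⟫_𝕜 := by
  set p : E := P w with hp'
  set q : E := w - P w with hq'
  have hp : P p = p := hPidem w
  have hq : P q = 0 := by rw [hq', map_sub, hPidem, sub_self]
  have hw : G w = G p + G q := by rw [← map_add, hp', hq', add_sub_cancel]
  obtain ⟨h1, h2⟩ := inner_weight_cross_eq_zero (𝕜 := 𝕜) hGP hq w
  have h3 : ⟪G p, P (A p)⟫_𝕜 = ⟪G p, A p⟫_𝕜 := by rw [hGP, hp]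
  have h4 : ⟪G q, P (A p)⟫_𝕜 = 0 := by rw [hGP, hq, map_zero, inner_zero_left]
  rw [hAn w, hw, inner_add_left, inner_add_right, inner_add_right, h3, h4, inner_smul_right,
    inner_smul_right, ← hp', h1, mul_zero, add_zero, zero_add, map_add, re_ofReal_mul]

/-- **The strong (3-L) certificate transfers to the extended generator, on all of `E`.** If the
untruncated operator satisfies (L) on `range P` — `Re⟪G (P w), A (P w)⟫ ≤ ω₁ Re⟪G (P w), P w⟫` for
every `w` — the weight is nonnegative on `ker P`, and `μ ≤ ω₁`, then
`Re⟪G w, A_n w⟫ ≤ ω₁ Re⟪G w, w⟫` for EVERY `w` (hypothesis `hL` of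
`BoundedGeneratorEmergence.norm_linearFlow_le_of_generator_form` at level `n`). -/
theorem strong_certificate_ext {P G : E →L[ℝ] E}
    (hGP : ∀ w z : E, ⟪G w, P z⟫_𝕜 = ⟪G (P w), z⟫_𝕜) (hPidem : ∀ w : E, P (P w) = P w)
    {A : E → E} {An : E → E} {μ ω₁ : ℝ}
    (hAn : ∀ w : E, An w = P (A (P w)) + ((μ : 𝕜) • (w - P w))) (hμ : μ ≤ ω₁)
    (hGpos : ∀ q : E, P q = 0 → 0 ≤ re ⟪G q, q⟫_𝕜)
    (hL : ∀ w : E, re ⟪G (P w), A (P w)⟫_𝕜 ≤ ω₁ * re ⟪G (P w), P w⟫_𝕜) :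
    ∀ w : E, re ⟪G w, An w⟫_𝕜 ≤ ω₁ * re ⟪G w, w⟫_𝕜 := by
  intro w
  have hq : P (w - P w) = 0 := by rw [map_sub, hPidem, sub_self]
  rw [re_inner_weight_ext hGP hPidem hAn w, re_inner_weight_split hGP hPidem w, mul_add]
  exact add_le_add (hL w) (mul_le_mul_of_nonneg_right hμ (hGpos _ hq))

/-- **The two-level (3-L′) coupled certificate transfers to the extended generator.** If on
`range P` the untruncated operator satisfies `2Re⟪G₁ p, A p⟫ + c Re⟪G₂ p, p⟫ ≤ 2ω Re⟪G₁ p, p⟫`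
(`p = P w`), both weights are `P`-compatible, and on `ker P` the TAIL INEQUALITY
`2μ Re⟪G₁ q, q⟫ + c Re⟪G₂ q, q⟫ ≤ 2ω Re⟪G₁ q, q⟫` holds (e.g. `G₂ ≤ κ G₁` there and
`μ ≤ ω − cκ/2`), then `2Re⟪G₁ w, A_n w⟫ + c Re⟪G₂ w, w⟫ ≤ 2ω Re⟪G₁ w, w⟫` for EVERY `w`
(hypothesis `h₁` of the g14/g15 theorems at level `n`). -/
theorem two_level_certificate_ext {P G₁ G₂ : E →L[ℝ] E}
    (hG₁P : ∀ w z : E, ⟪G₁ w, P z⟫_𝕜 = ⟪G₁ (P w), z⟫_𝕜)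
    (hG₂P : ∀ w z : E, ⟪G₂ w, P z⟫_𝕜 = ⟪G₂ (P w), z⟫_𝕜) (hPidem : ∀ w : E, P (P w) = P w)
    {A : E → E} {An : E → E} {μ ω c : ℝ}
    (hAn : ∀ w : E, An w = P (A (P w)) + ((μ : 𝕜) • (w - P w)))
    (htail : ∀ q : E, P q = 0 →
      2 * μ * re ⟪G₁ q, q⟫_𝕜 + c * re ⟪G₂ q, q⟫_𝕜 ≤ 2 * ω * re ⟪G₁ q, q⟫_𝕜)
    (h₁ : ∀ w : E, 2 * re ⟪G₁ (P w), A (P w)⟫_𝕜 + c * re ⟪G₂ (P w), P w⟫_𝕜 ≤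
      2 * ω * re ⟪G₁ (P w), P w⟫_𝕜) :
    ∀ w : E, 2 * re ⟪G₁ w, An w⟫_𝕜 + c * re ⟪G₂ w, w⟫_𝕜 ≤ 2 * ω * re ⟪G₁ w, w⟫_𝕜 := by
  intro w
  have hq : P (w - P w) = 0 := by rw [map_sub, hPidem, sub_self]
  rw [re_inner_weight_ext hG₁P hPidem hAn w, re_inner_weight_split hG₂P hPidem w,
    re_inner_weight_split hG₁P hPidem w]
  have ht := htail _ hq
  have hh := h₁ w
  nlinarith

/-- **The weak-level certificate `Re⟪G₂ w, A w⟫ ≤ ω Re⟪G₂ w, w⟫` transfers to the extended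
generator** (hypothesis `h₂` at level `n`): `μ ≤ ω` and `Re⟪G₂ q, q⟫ ≥ 0` on `ker P` suffice. -/
theorem weak_certificate_ext {P G₂ : E →L[ℝ] E}
    (hG₂P : ∀ w z : E, ⟪G₂ w, P z⟫_𝕜 = ⟪G₂ (P w), z⟫_𝕜) (hPidem : ∀ w : E, P (P w) = P w)
    {A : E → E} {An : E → E} {μ ω : ℝ}
    (hAn : ∀ w : E, An w = P (A (P w)) + ((μ : 𝕜) • (w - P w))) (hμ : μ ≤ ω)
    (hG₂pos : ∀ q : E, P q = 0 → 0 ≤ re ⟪G₂ q, q⟫_𝕜)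
    (h₂ : ∀ w : E, re ⟪G₂ (P w), A (P w)⟫_𝕜 ≤ ω * re ⟪G₂ (P w), P w⟫_𝕜) :
    ∀ w : E, re ⟪G₂ w, An w⟫_𝕜 ≤ ω * re ⟪G₂ w, w⟫_𝕜 :=
  strong_certificate_ext hG₂P hPidem hAn hμ hG₂pos h₂

/-! ### (B), the Galerkin structure of the field, and the eigen-residual -/

/-- **`P` is a `D₁`-contraction when `D₁` is `P`-compatible and nonnegative on `ker P`:**
`Re⟪D₁ (P z), P z⟫ ≤ Re⟪D₁ z, z⟫`. -/
theorem re_inner_weight_proj_le {P D₁ : E →L[ℝ] E}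
    (hD₁P : ∀ w z : E, ⟪D₁ w, P z⟫_𝕜 = ⟪D₁ (P w), z⟫_𝕜) (hPidem : ∀ w : E, P (P w) = P w)
    (hD₁pos : ∀ q : E, P q = 0 → 0 ≤ re ⟪D₁ q, q⟫_𝕜) (z : E) :
    re ⟪D₁ (P z), P z⟫_𝕜 ≤ re ⟪D₁ z, z⟫_𝕜 := by
  have hq : P (z - P z) = 0 := by rw [map_sub, hPidem, sub_self]
  rw [re_inner_weight_split hD₁P hPidem z]
  linarith [hD₁pos _ hq]

/-- **(B) for the truncated nonlinearity `B_n = P ∘ B`.** If `√Re⟪D₁ (B x y), B x y⟫ ≤ c_alg ‖x‖ ‖y‖`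
and `P` is a `D₁`-contraction (`re_inner_weight_proj_le`), then
`√Re⟪D₁ (P (B x y)), P (B x y)⟫ ≤ c_alg ‖x‖ ‖y‖` — hypothesis `hB` at level `n`, same constant. -/
theorem bilinear_loss_proj {P D₁ : E →L[ℝ] E}
    (hD₁P : ∀ w z : E, ⟪D₁ w, P z⟫_𝕜 = ⟪D₁ (P w), z⟫_𝕜) (hPidem : ∀ w : E, P (P w) = P w)
    (hD₁pos : ∀ q : E, P q = 0 → 0 ≤ re ⟪D₁ q, q⟫_𝕜) {B : E → E → E} {calg : ℝ}
    (hB : ∀ x y : E, Real.sqrt (re ⟪D₁ (B x y), B x y⟫_𝕜) ≤ calg * ‖x‖ * ‖y‖) :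
    ∀ x y : E, Real.sqrt (re ⟪D₁ (P (B x y)), P (B x y)⟫_𝕜) ≤ calg * ‖x‖ * ‖y‖ :=
  fun x y => (Real.sqrt_le_sqrt (re_inner_weight_proj_le hD₁P hPidem hD₁pos (B x y))).trans
    (hB x y)

/-- **The Galerkin structure of the truncated field** (hypothesis `hfield` of
`GalerkinEmergenceTrue.galerkin_level_classical`): if `F w = A w + B (w, w)` on `W` (formally — `F`
may carry junk values off `W`), then on `W ∩ range P` the truncated field reads
`P (F w) = A_n w + P (B (w, w))` for the extended generator `A_n`. -/
theorem galerkin_field_ext {P : E →L[ℝ] E} {F A : E → E} {B : E → E → E} {W : Set E}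
    (hF : ∀ w ∈ W, F w = A w + B w w) {An : E → E} {μ : ℝ}
    (hAn : ∀ w : E, An w = P (A (P w)) + ((μ : 𝕜) • (w - P w))) :
    ∀ w ∈ W, P w = w → P (F w) = An w + P (B w w) := by
  intro w hw hPw
  rw [hF w hw, map_add, hAn w, hPw, sub_self, smul_zero, add_zero]

/-- **The eigen-residual of the extended generator on a true eigenvector.** If `A` is (real-)linear
with `A v = λ v`, then `A_n (P v) − λ P v = −P (A (v − P v))`: the consistency hypothesis (iv) of
`GalerkinEmergenceTrue.half_prediction_of_galerkin_limit` reads `‖P_n (A (v − P_n v))‖ → 0` — for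
Fourier truncations and `v` in the graph norm of `A` this is the tail of `A v`-type sums. -/
theorem eigen_residual_ext {P : E →L[ℝ] E} (hPidem : ∀ w : E, P (P w) = P w)
    (A : E →ₗ[ℝ] E) {An : E → E} {μ : ℝ}
    (hAn : ∀ w : E, An w = P (A (P w)) + ((μ : 𝕜) • (w - P w))) {v : E} {lam : ℝ}
    (hAv : A v = lam • v) :
    An (P v) - lam • P v = -(P (A (v - P v))) := by
  rw [hAn (P v), hPidem, sub_self, smul_zero, add_zero, map_sub A, hAv, map_sub P, map_smul]
  abel

/-- Hence the norm form used as hypothesis (iv): `‖A_n (P v) − λ P v‖ = ‖P (A (v − P v))‖`. -/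
theorem norm_eigen_residual_ext {P : E →L[ℝ] E} (hPidem : ∀ w : E, P (P w) = P w)
    (A : E →ₗ[ℝ] E) {An : E → E} {μ : ℝ}
    (hAn : ∀ w : E, An w = P (A (P w)) + ((μ : 𝕜) • (w - P w))) {v : E} {lam : ℝ}
    (hAv : A v = lam • v) :
    ‖An (P v) - lam • P v‖ = ‖P (A (v - P v))‖ := by
  rw [eigen_residual_ext (𝕜 := 𝕜) hPidem A hAn hAv, norm_neg]

end Summit.NavierStokesRegularity.FluidComputer.GalerkinCertificateTransfer

end
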